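import Summits.QuantumFields.QCD.Theorems.ExtinctionBuildsQCD.Negative.CoercivityCeiling

/-!
# `WindowExtinction` (crux stmt-QuantumFields-18063, SD⁺) — negative-side support:
# the phase-quenched index is EXTINCT at and above every sea mass; TIGHT probed above the line is false

Standing crux disprover of the hinge (cdisprove seat on the RESTATED crux, 2026-08-17), certified copy of
§11b of `Summits/QuantumFields/QCD/Cruxes/WindowExtinction/Disproof.lean`.  Sorry-free, NO definitions, asserts no
route item; built on the sibling seat's landed `ExtinctionBuildsQCD/Negative/{IndexBudget, WeylWindow,
ExtinctIntegrable, CoercivityCeiling}.lean` (`abs_index_le_realModeCount`, `fermionDet_eq_zero_of_root`,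
`countP_realModes_le_eq`, `integrable_extinctIntegrand`, `extinctRatio`, `Extinct`).

The TIGHT⁺ clause of SD⁺ probes the spectral index `n₋(Γ₅D_W(U, p, 1)) − 6(2L_k+1)⁴` at `p = m_crit(k) − a_kM/Z_k`,
BELOW the witness's line.  This module records what EXTINCT(a) alone says about every probe AT OR ABOVE a sea mass
`m_f(k) = m_crit(k) + a_k m_f/Z_k`, and that the sign of the probe offset is load-bearing:

* `absIndex_mul_weight_le_extinct_mul` (every gauge field): for `p ≥ m_{f₀}(k)`,
  `|n₋(Γ₅D_W(U,p,1)) − 6(2S+1)⁴| · W(U) ≤ (EXTINCT integrand)(U) · W(U)`, `W = ∏_f |det D_W(U, m_f(k), 1)|`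
  (index ≤ real modes `≤ −p ≤ −m_{f₀}(k)` by the landed crossing budget; the boundary atom `λ = −m_{f₀}(k)` kills
  the weight).
* `absIndexRatio_le_extinctRatio`, `eventually_absIndexRatio_le_of_extinct`: for witness data EXTINCT at a tuple `m`,
  every flavour `f₀` and `ε > 0`, eventually in `k`, ON EVERY TORUS `S ≥ L_k` and at EVERY probe `p ≥ m_{f₀}(k)`:
  `E₊|index(p)| ≤ ε ((2S+1)/(2L_k+1))⁴`.  With TIGHT⁺ (`index_jump_of_windowExtinction`): the phase-quenched
  `E₊|index|` of an SD⁺ witness jumps from `≤ ε` at `m_crit(k) + a_k m_f/Z_k` to `≥ max 1 (η (a_k(2L_k+1))²)` at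
  `m_crit(k) − a_k M/Z_k` — all net spectral flow of `H_W` sits inside the window of bare width `a_k(m_f+M)/Z_k` at
  the line (the index currency of the two-sided pin, `TwoSidedPin.lean`, which is stated in count currency).
* `not_extinct_and_tightAbove`, `not_windowExtinction_probeAbove`: the variant of the crux whose TIGHT clause probes
  ABOVE the line (`m_crit(k) + a_kM/Z_k`, any floor `≥ 1`, in particular TIGHT⁺'s) is FALSE for every
  regularisation, threshold and window constant: at the tuple `m ≡ M₀+1` and probe `M = M₀+1` the probe IS the sea
  mass, so `1 ≤ E₊|index| ≤ 1/2` eventually.  Together with `TipPricing/Negative/ReflectionSignedTight.lean` (the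
  `|·|` is essential) and `WindowExtinction/Negative/UniformTight.lean` (`∀ M, ∀ᶠ k` cannot be swapped) this completes
  the list of cheap symmetries of the pin: only the below-the-line, modulus, pointwise-in-`M` form is consistent
  with EXTINCT.

References: Edwards–Heller–Narayanan, Nucl. Phys. B 535 (1998) 403 (spectral flow of `H_W(m)`: no net crossings on
the physical side of the branch point); Itoh–Iwasaki–Yoshié, Phys. Rev. D 36 (1987) 527.
-/

noncomputable section

namespace Summit.QuantumFields.QCD.Theorems.WindowExtinction.Negative

open scoped BigOperators Topology Classical MeasureTheory Matrix ComplexConjugate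
open Filter MeasureTheory Matrix
open Literature.MathematicalPhysics.QuantumLattice Literature.MathematicalPhysics.QuantumFieldTheory
  Literature.Probability.LatticeModels
open Summit.QuantumFields.QCD.Theses.SpectralDefectExtinction
open Summit.QuantumFields.QCD.Theorems.ExtinctionBuildsQCD.Negative

section AboveLine

variable {Nf : ℕ}

/-! ## §1 Pointwise: the index at any probe at or above a sea mass is dominated by EXTINCT -/

/-- One flavour's sign-defect count is at most the EXTINCT integrand (flavour sum of non-negative counts). -/
theorem signDefects_le_extinctSum (reg : QCDRegularisation Nf) {L : ℕ} [NeZero L]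
    (U : GaugeConfig 4 L (Matrix.specialUnitaryGroup (Fin 3) ℂ)) (c : ℝ) (k : ℕ) (m : Fin Nf → ℝ) (f₀ : Fin Nf) :
    (Multiset.countP (fun z : ℂ => z.im = 0 ∧ z.re < -(reg.mcrit k + reg.a k * m f₀ / reg.Zm k)) (wilsonDirac (fundamentalRep (Fin 3)) U 0 1).charpoly.roots : ℝ) ≤
      ∑ f : Fin Nf, ((Multiset.countP (fun z : ℂ => z.im = 0 ∧ z.re < -(reg.mcrit k + reg.a k * m f / reg.Zm k)) (wilsonDirac (fundamentalRep (Fin 3)) U 0 1).charpoly.roots : ℝ) + (Multiset.countP (fun z : ℂ => |z.re| < c * (reg.a k * m f / reg.Zm k)) (spinorLift gammaFive * wilsonDirac (fundamentalRep (Fin 3)) U (reg.mcrit k + reg.a k * m f / reg.Zm k) 1).charpoly.roots : ℝ)) := by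
  have h := Finset.single_le_sum (f := fun f : Fin Nf => ((Multiset.countP (fun z : ℂ => z.im = 0 ∧ z.re < -(reg.mcrit k + reg.a k * m f / reg.Zm k)) (wilsonDirac (fundamentalRep (Fin 3)) U 0 1).charpoly.roots : ℝ) + (Multiset.countP (fun z : ℂ => |z.re| < c * (reg.a k * m f / reg.Zm k)) (spinorLift gammaFive * wilsonDirac (fundamentalRep (Fin 3)) U (reg.mcrit k + reg.a k * m f / reg.Zm k) 1).charpoly.roots : ℝ)))
    (fun _ _ => add_nonneg (Nat.cast_nonneg _) (Nat.cast_nonneg _)) (Finset.mem_univ f₀)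
  have h0 : (0 : ℝ) ≤ (Multiset.countP (fun z : ℂ => |z.re| < c * (reg.a k * m f₀ / reg.Zm k)) (spinorLift gammaFive * wilsonDirac (fundamentalRep (Fin 3)) U (reg.mcrit k + reg.a k * m f₀ / reg.Zm k) 1).charpoly.roots : ℝ) :=
    Nat.cast_nonneg _
  linarith

/-- **Index at or above a sea mass ≤ EXTINCT integrand, pointwise with the phase-quenched weight.** For witness
data `reg`, window constant `c`, step `k`, tuple `m`, a flavour `f₀` and any probe mass `p ≥ m_{f₀}(k)`, on every
gauge field of the torus `(2S+1)⁴`: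
`|n₋(Γ₅D_W(U,p,1)) − 6(2S+1)⁴| · W ≤ (Σ_f [sign defects + coercivity defects]) · W`. -/
theorem absIndex_mul_weight_le_extinct_mul {S : ℕ} (U : GaugeConfig 4 (2 * S + 1) (Matrix.specialUnitaryGroup (Fin 3) ℂ))
    (reg : QCDRegularisation Nf) (c : ℝ) (k : ℕ) (m : Fin Nf → ℝ) (f₀ : Fin Nf) {p : ℝ}
    (hp : reg.mcrit k + reg.a k * m f₀ / reg.Zm k ≤ p) :
    |(Multiset.countP (fun z : ℂ => z.re < 0) (spinorLift gammaFive * wilsonDirac (fundamentalRep (Fin 3)) U p 1).charpoly.roots : ℝ) - 6 * (2 * S + 1 : ℝ) ^ 4| * ∏ f : Fin Nf, ‖fermionDet (wilsonDirac (fundamentalRep (Fin 3)) U (reg.mcrit k + reg.a k * m f / reg.Zm k) 1)‖ ≤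
      (∑ f : Fin Nf, ((Multiset.countP (fun z : ℂ => z.im = 0 ∧ z.re < -(reg.mcrit k + reg.a k * m f / reg.Zm k)) (wilsonDirac (fundamentalRep (Fin 3)) U 0 1).charpoly.roots : ℝ) + (Multiset.countP (fun z : ℂ => |z.re| < c * (reg.a k * m f / reg.Zm k)) (spinorLift gammaFive * wilsonDirac (fundamentalRep (Fin 3)) U (reg.mcrit k + reg.a k * m f / reg.Zm k) 1).charpoly.roots : ℝ))) * ∏ f : Fin Nf, ‖fermionDet (wilsonDirac (fundamentalRep (Fin 3)) U (reg.mcrit k + reg.a k * m f / reg.Zm k) 1)‖ := by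
  set μ₀ : ℝ := reg.mcrit k + reg.a k * m f₀ / reg.Zm k with hμ₀
  by_cases hdet : fermionDet (wilsonDirac (fundamentalRep (Fin 3)) U μ₀ 1) = 0
  · -- a real eigenvalue of `D_W(U,0,1)` exactly at `−m_{f₀}(k)`: the weight vanishes
    have hWz : (∏ f : Fin Nf, ‖fermionDet (wilsonDirac (fundamentalRep (Fin 3)) U
        (reg.mcrit k + reg.a k * m f / reg.Zm k) 1)‖) = 0 :=
      Finset.prod_eq_zero (Finset.mem_univ f₀) (by rw [← hμ₀, hdet, norm_zero])
    rw [hWz, mul_zero, mul_zero]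
  · refine mul_le_mul_of_nonneg_right ?_ (Finset.prod_nonneg fun f _ => norm_nonneg _)
    -- no atom at `−μ₀`
    have hatom : Multiset.countP (fun z : ℂ => z = ((-μ₀ : ℝ) : ℂ))
        (wilsonDirac (fundamentalRep (Fin 3)) U 0 1).charpoly.roots = 0 :=
      Multiset.countP_eq_zero.2 fun z hz h => hdet (fermionDet_eq_zero_of_root U _ hz h)
    -- crossing budget at the probe `p`: index ≤ real modes `≤ −p`
    have hZ := abs_index_le_realModeCount U p
    have hRe : |(Multiset.countP (fun z : ℂ => z.re < 0) (spinorLift gammaFive * wilsonDirac (fundamentalRep (Fin 3)) U p 1).charpoly.roots : ℝ) - 6 * (2 * S + 1 : ℝ) ^ 4| ≤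
        (Multiset.countP (fun z : ℂ => z.im = 0 ∧ z.re ≤ -p) (wilsonDirac (fundamentalRep (Fin 3)) U 0 1).charpoly.roots : ℝ) := by
      exact_mod_cast hZ
    -- real modes `≤ −p` ⊆ real modes `≤ −μ₀` = sign defects of `f₀` + the (empty) atom
    have hmono : (Multiset.countP (fun z : ℂ => z.im = 0 ∧ z.re ≤ -p) (wilsonDirac (fundamentalRep (Fin 3)) U 0 1).charpoly.roots : ℝ) ≤
        (Multiset.countP (fun z : ℂ => z.im = 0 ∧ z.re ≤ -μ₀) (wilsonDirac (fundamentalRep (Fin 3)) U 0 1).charpoly.roots : ℝ) := by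
      exact_mod_cast countP_le_countP_of_imp (p := fun z : ℂ => z.im = 0 ∧ z.re ≤ -p)
        (q := fun z : ℂ => z.im = 0 ∧ z.re ≤ -μ₀) _ fun z hz => ⟨hz.1, hz.2.trans (by linarith)⟩
    have hsplit : (Multiset.countP (fun z : ℂ => z.im = 0 ∧ z.re ≤ -μ₀) (wilsonDirac (fundamentalRep (Fin 3)) U 0 1).charpoly.roots : ℝ) =
        (Multiset.countP (fun z : ℂ => z.im = 0 ∧ z.re < -μ₀) (wilsonDirac (fundamentalRep (Fin 3)) U 0 1).charpoly.roots : ℝ) := by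
      rw [countP_realModes_le_eq U, hatom, add_zero]
    have hsum := signDefects_le_extinctSum reg U c k m f₀
    rw [← hμ₀] at hsum
    linarith

/-! ## §2 The phase-quenched mean of `|index|` above the sea masses is extinct -/

/-- **`E₊|index(p)| ≤ extinctRatio` for every probe `p ≥ m_{f₀}(k)`** (any torus `(2S+1)⁴`, any step; the phase-quenched
mean written out: numerator `∫ |n₋ − 6(2S+1)⁴|·W`, denominator `∫ W`; the EXTINCT integrand is integrable,
`integrable_extinctIntegrand`, and the denominators agree). -/
theorem absIndexRatio_le_extinctRatio (reg : QCDRegularisation Nf) (c : ℝ) (k S : ℕ) (m : Fin Nf → ℝ)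
    (f₀ : Fin Nf) {p : ℝ} (hp : reg.mcrit k + reg.a k * m f₀ / reg.Zm k ≤ p) :
    (∫ U, |(Multiset.countP (fun z : ℂ => z.re < 0) (spinorLift gammaFive * wilsonDirac (fundamentalRep (Fin 3)) U p 1).charpoly.roots : ℝ) - 6 * (2 * S + 1 : ℝ) ^ 4| * ∏ f : Fin Nf, ‖fermionDet (wilsonDirac (fundamentalRep (Fin 3)) U (reg.mcrit k + reg.a k * m f / reg.Zm k) 1)‖ ∂(wilsonMeasure (d := 4) (L := 2 * S + 1) (fundamentalRep (Fin 3)) (reg.β k))) / (∫ U, ∏ f : Fin Nf, ‖fermionDet (wilsonDirac (fundamentalRep (Fin 3)) U (reg.mcrit k + reg.a k * m f / reg.Zm k) 1)‖ ∂(wilsonMeasure (d := 4) (L := 2 * S + 1) (fundamentalRep (Fin 3)) (reg.β k))) ≤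
      extinctRatio reg c k S m := by
  unfold extinctRatio
  refine div_le_div_of_nonneg_right ?_
    (integral_nonneg fun _ => Finset.prod_nonneg fun _ _ => norm_nonneg _)
  refine integral_mono_of_nonneg (Eventually.of_forall fun U => ?_)
    (integrable_extinctIntegrand reg c k m (reg.β k)) (Eventually.of_forall fun U => ?_)
  · exact mul_nonneg (abs_nonneg _) (Finset.prod_nonneg fun f _ => norm_nonneg _)
  · exact absIndex_mul_weight_le_extinct_mul U reg c k m f₀ hp

/-- **EXTINCT ⇒ the phase-quenched index is extinct at and above every sea mass, on every torus ≥ the scheme's.**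
For witness data EXTINCT at the tuple `m` (window constant `c`), every flavour `f₀` and `ε > 0`: eventually in `k`,
for every `S ≥ L_k` and every probe `p ≥ m_{f₀}(k) = m_crit(k) + a_k m_{f₀}/Z_k`,
`E₊ |n₋(Γ₅D_W(U,p,1)) − 6(2S+1)⁴| ≤ ε ((2S+1)/(2L_k+1))⁴`. -/
theorem eventually_absIndexRatio_le_of_extinct (reg : QCDRegularisation Nf) {c : ℝ} {m : Fin Nf → ℝ}
    (hE : Extinct Nf reg c m) (f₀ : Fin Nf) {ε : ℝ} (hε : 0 < ε) :
    ∀ᶠ k : ℕ in Filter.atTop, ∀ S : ℕ, reg.L k ≤ S → ∀ p : ℝ, reg.mcrit k + reg.a k * m f₀ / reg.Zm k ≤ p →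
      (∫ U, |(Multiset.countP (fun z : ℂ => z.re < 0) (spinorLift gammaFive * wilsonDirac (fundamentalRep (Fin 3)) U p 1).charpoly.roots : ℝ) - 6 * (2 * S + 1 : ℝ) ^ 4| * ∏ f : Fin Nf, ‖fermionDet (wilsonDirac (fundamentalRep (Fin 3)) U (reg.mcrit k + reg.a k * m f / reg.Zm k) 1)‖ ∂(wilsonMeasure (d := 4) (L := 2 * S + 1) (fundamentalRep (Fin 3)) (reg.β k))) / (∫ U, ∏ f : Fin Nf, ‖fermionDet (wilsonDirac (fundamentalRep (Fin 3)) U (reg.mcrit k + reg.a k * m f / reg.Zm k) 1)‖ ∂(wilsonMeasure (d := 4) (L := 2 * S + 1) (fundamentalRep (Fin 3)) (reg.β k))) ≤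
        ε * ((2 * S + 1 : ℝ) / (2 * reg.L k + 1)) ^ 4 := by
  filter_upwards [(extinct_iff_extinctRatio reg c m).1 hE ε hε] with k hk S hS p hp
  exact (absIndexRatio_le_extinctRatio reg c k S m f₀ hp).trans (hk S hS)

/-- Scheme-torus form: eventually `E₊|index(p)| ≤ ε` at every probe `p ≥ m_{f₀}(k)` on the torus `(2L_k+1)⁴`. -/
theorem eventually_absIndexRatio_le_of_extinct_scheme (reg : QCDRegularisation Nf) {c : ℝ} {m : Fin Nf → ℝ}
    (hE : Extinct Nf reg c m) (f₀ : Fin Nf) {ε : ℝ} (hε : 0 < ε) :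
    ∀ᶠ k : ℕ in Filter.atTop, ∀ p : ℝ, reg.mcrit k + reg.a k * m f₀ / reg.Zm k ≤ p →
      (∫ U, |(Multiset.countP (fun z : ℂ => z.re < 0) (spinorLift gammaFive * wilsonDirac (fundamentalRep (Fin 3)) U p 1).charpoly.roots : ℝ) - 6 * (2 * reg.L k + 1 : ℝ) ^ 4| * ∏ f : Fin Nf, ‖fermionDet (wilsonDirac (fundamentalRep (Fin 3)) U (reg.mcrit k + reg.a k * m f / reg.Zm k) 1)‖ ∂(wilsonMeasure (d := 4) (L := 2 * reg.L k + 1) (fundamentalRep (Fin 3)) (reg.β k))) / (∫ U, ∏ f : Fin Nf, ‖fermionDet (wilsonDirac (fundamentalRep (Fin 3)) U (reg.mcrit k + reg.a k * m f / reg.Zm k) 1)‖ ∂(wilsonMeasure (d := 4) (L := 2 * reg.L k + 1) (fundamentalRep (Fin 3)) (reg.β k))) ≤ ε := by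
  filter_upwards [eventually_absIndexRatio_le_of_extinct reg hE f₀ hε] with k hk p hp
  have h := hk (reg.L k) le_rfl p hp
  have hone : ((2 * (reg.L k : ℕ) + 1 : ℝ) / (2 * reg.L k + 1)) = 1 := div_self (by positivity)
  rw [hone, one_pow, mul_one] at h
  exact_mod_cast h

/-! ## §3 TIGHT probed ABOVE the line is false for every witness -/

/-- **EXTINCT ∧ TIGHT-above is unsatisfiable.** For every regularisation `reg`, threshold `M₀`, window constant `c` and
`N_f ≥ 1`: it is impossible that every tuple above `M₀` is EXTINCT and satisfies the TIGHT clause with the probe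
MIRRORED to `m_crit(k) + a_kM/Z_k` (floor `1`; any floor `≥ 1` implies it) — at `m ≡ M₀+1`, `M = M₀+1` the probe is the
common sea mass, where `E₊|index| ≤ 1/2` eventually. -/
theorem not_extinct_and_tightAbove (hNf : 0 < Nf) (reg : QCDRegularisation Nf) (M₀ c : ℝ) :
    ¬ ∀ m : Fin Nf → ℝ, (∀ f, M₀ < m f) → Extinct Nf reg c m ∧
      ∀ M : ℝ, M₀ < M → ∀ᶠ k : ℕ in Filter.atTop, 1 ≤ (∫ U, (|(Multiset.countP (fun z : ℂ => z.re < 0) (spinorLift gammaFive * wilsonDirac (fundamentalRep (Fin 3)) U (reg.mcrit k + reg.a k * M / reg.Zm k) 1).charpoly.roots : ℝ) - 6 * (2 * reg.L k + 1 : ℝ) ^ 4|) * ∏ f : Fin Nf, ‖fermionDet (wilsonDirac (fundamentalRep (Fin 3)) U (reg.mcrit k + reg.a k * m f / reg.Zm k) 1)‖ ∂(wilsonMeasure (d := 4) (L := 2 * reg.L k + 1) (fundamentalRep (Fin 3)) (reg.β k))) / (∫ U, ∏ f : Fin Nf, ‖fermionDet (wilsonDirac (fundamentalRep (Fin 3))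 U (reg.mcrit k + reg.a k * m f / reg.Zm k) 1)‖ ∂(wilsonMeasure (d := 4) (L := 2 * reg.L k + 1) (fundamentalRep (Fin 3)) (reg.β k))) := by
  intro h
  obtain ⟨hE, hT⟩ := h (fun _ => M₀ + 1) fun _ => by linarith
  have hT' := hT (M₀ + 1) (by linarith)
  have hE' := eventually_absIndexRatio_le_of_extinct_scheme reg hE ⟨0, hNf⟩ (ε := 1 / 2) (by norm_num)
  obtain ⟨k, hTk, hEk⟩ := (hT'.and hE').exists
  have := hEk (reg.mcrit k + reg.a k * (M₀ + 1) / reg.Zm k) le_rfl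
  linarith

/-- **The crux with its probe mirrored above the line is FALSE**: verbatim the body of the restated `WindowExtinction`
(SD⁺: mass scaling, asymptotic scaling, cap, branch, EXTINCT, extensive floor `max 1 (η (a_k(2L_k+1))²)`) except that the
TIGHT⁺ integrand is evaluated at `m_crit(k) + a_kM/Z_k` instead of `m_crit(k) − a_kM/Z_k`. Already at `N_f = 2`, for the
witness's own data, `not_extinct_and_tightAbove` applies: the sign of the probe offset is load-bearing. -/
theorem not_windowExtinction_probeAbove :
    ¬ ∀ Nf : ℕ, (Nf = 2 ∨ Nf = 3) → ∃ reg : QCDRegularisation Nf, reg.HasMassScaling ∧ (reg.scheme 0 0 0).HasAsymptoticScaling ∧ (∃ p : ℕ, ∀ᶠ k : ℕ in Filter.atTop, (reg.L k : ℝ) ≤ (reg.a k)⁻¹ ^ p) ∧ (∀ᶠ k : ℕ in Filter.atTop, -1 < reg.mcrit k) ∧ ∃ M₀ : ℝ, 0 ≤ M₀ ∧ ∃ c : ℝ, 0 < c ∧ ∀ m : Fin Nf → ℝ, (∀ f, M₀ < m f) → (∀ ε : ℝ, 0 < ε → ∀ᶠ k : ℕ in Filter.atTop, ∀ S : ℕ,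 reg.L k ≤ S → (∫ U, ((∑ f : Fin Nf, ((Multiset.countP (fun z : ℂ => z.im = 0 ∧ z.re < -(reg.mcrit k + reg.a k * m f / reg.Zm k)) (wilsonDirac (fundamentalRep (Fin 3)) U 0 1).charpoly.roots : ℝ) + (Multiset.countP (fun z : ℂ => |z.re| < c * (reg.a k * m f / reg.Zm k)) (spinorLift gammaFive * wilsonDirac (fundamentalRep (Fin 3)) U (reg.mcrit k + reg.a k * m f / reg.Zm k) 1).charpoly.roots : ℝ)))) * ∏ f : Fin Nf, ‖fermionDet (wilsonDirac (fundamentalRep (Fin 3)) U (reg.mcrit k + reg.a k * m f / reg.Zm k) 1)‖ ∂(wilsonMeasure (d := 4) (L := 2 * S + 1) (fundamentalRep (Fin 3)) (reg.β k))) / (∫ U, ∏ f : Fin Nf, ‖fermionDet (wilsonDirac (fundamentalRep (Fin 3)) U (reg.mcrit k + reg.a k * m f / reg.Zm k) 1)‖ ∂(wilsonMeasure (d := 4) (L := 2 * S + 1) (fundamentalRep (Fin 3)) (reg.β k))) ≤ ε * ((2 * S + 1 : ℝ) / (2 * reg.L k + 1)) ^ 4) ∧ (∃ η : ℝ, 0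 < η ∧ ∀ M : ℝ, M₀ < M → ∀ᶠ k : ℕ in Filter.atTop, max 1 (η * (reg.a k * (2 * reg.L k + 1 : ℝ)) ^ 2) ≤ (∫ U, (|(Multiset.countP (fun z : ℂ => z.re < 0) (spinorLift gammaFive * wilsonDirac (fundamentalRep (Fin 3)) U (reg.mcrit k + reg.a k * M / reg.Zm k) 1).charpoly.roots : ℝ) - 6 * (2 * reg.L k + 1 : ℝ) ^ 4|) * ∏ f : Fin Nf, ‖fermionDet (wilsonDirac (fundamentalRep (Fin 3)) U (reg.mcrit k + reg.a k * m f / reg.Zm k) 1)‖ ∂(wilsonMeasure (d := 4) (L := 2 * reg.L k + 1) (fundamentalRep (Fin 3)) (reg.β k))) / (∫ U, ∏ f : Fin Nf, ‖fermionDet (wilsonDirac (fundamentalRep (Fin 3)) U (reg.mcrit k + reg.a k * m f / reg.Zm k) 1)‖ ∂(wilsonMeasure (d := 4) (L := 2 * reg.L k + 1) (fundamentalRep (Fin 3)) (reg.β k)))) := by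
  intro h
  obtain ⟨reg, -, -, -, -, M₀, -, c, -, hm⟩ := h 2 (Or.inl rfl)
  refine not_extinct_and_tightAbove (Nf := 2) two_pos reg M₀ c fun m hmM => ⟨(hm m hmM).1, fun M hM => ?_⟩
  obtain ⟨η, -, hT⟩ := (hm m hmM).2
  exact (hT M hM).mono fun k hk => le_trans (le_max_left _ _) hk

/-! ## §4 Reading for SD⁺ witnesses: the index jump across the window at the line -/

/-- **THE INDEX JUMP.** The restated crux hands, at `N_f ∈ {2,3}`, a regularisation `reg` and `M₀ ≥ 0` such that for
every tuple `m` above `M₀` there is `η > 0` with: for every flavour `f₀`, probe parameter `M > M₀` and `ε > 0`, eventually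
in `k`, on the scheme torus, `E₊|index(p)| ≤ ε` for EVERY `p ≥ m_crit(k) + a_k m_{f₀}/Z_k` while
`E₊|index(m_crit(k) − a_kM/Z_k)| ≥ max 1 (η (a_k(2L_k+1))²)`: all net spectral flow of `H_W` — `≳ η√V_phys` levels in
phase-quenched mean — crosses inside the window `(m_crit(k) − a_kM/Z_k, m_crit(k) + a_k m_{f₀}/Z_k)` of bare width
`a_k(m_{f₀}+M)/Z_k → 0`, and nothing net crosses above it. -/
theorem index_jump_of_windowExtinction (h : WindowExtinction) {Nf : ℕ} (hNf : Nf = 2 ∨ Nf = 3) :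
    ∃ reg : QCDRegularisation Nf, ∃ M₀ : ℝ, 0 ≤ M₀ ∧ ∀ m : Fin Nf → ℝ, (∀ f, M₀ < m f) →
      ∃ η : ℝ, 0 < η ∧ ∀ f₀ : Fin Nf, ∀ M : ℝ, M₀ < M → ∀ ε : ℝ, 0 < ε → ∀ᶠ k : ℕ in Filter.atTop,
        (∀ p : ℝ, reg.mcrit k + reg.a k * m f₀ / reg.Zm k ≤ p →
          (∫ U, |(Multiset.countP (fun z : ℂ => z.re < 0) (spinorLift gammaFive * wilsonDirac (fundamentalRep (Fin 3)) U p 1).charpoly.roots : ℝ) - 6 * (2 * reg.L k + 1 : ℝ) ^ 4| * ∏ f : Fin Nf, ‖fermionDet (wilsonDirac (fundamentalRep (Fin 3)) U (reg.mcrit k + reg.a k * m f / reg.Zm k) 1)‖ ∂(wilsonMeasure (d := 4) (L := 2 * reg.L k + 1) (fundamentalRep (Fin 3)) (reg.β k))) / (∫ U, ∏ f : Fin Nf, ‖fermionDet (wilsonDirac (fundamentalRep (Fin 3)) U (reg.mcrit k + reg.a k * m f / reg.Zm k) 1)‖ ∂(wilsonMeasure (d := 4) (L := 2 * reg.L k +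 1) (fundamentalRep (Fin 3)) (reg.β k))) ≤ ε) ∧
        max 1 (η * (reg.a k * (2 * reg.L k + 1 : ℝ)) ^ 2) ≤
          (∫ U, (|(Multiset.countP (fun z : ℂ => z.re < 0) (spinorLift gammaFive * wilsonDirac (fundamentalRep (Fin 3)) U (reg.mcrit k - reg.a k * M / reg.Zm k) 1).charpoly.roots : ℝ) - 6 * (2 * reg.L k + 1 : ℝ) ^ 4|) * ∏ f : Fin Nf, ‖fermionDet (wilsonDirac (fundamentalRep (Fin 3)) U (reg.mcrit k + reg.a k * m f / reg.Zm k) 1)‖ ∂(wilsonMeasure (d := 4) (L := 2 * reg.L k + 1) (fundamentalRep (Fin 3)) (reg.β k))) / (∫ U, ∏ f : Fin Nf, ‖fermionDet (wilsonDirac (fundamentalRep (Fin 3)) U (reg.mcrit k + reg.a k * m f / reg.Zm k) 1)‖ ∂(wilsonMeasure (d := 4) (L := 2 * reg.L k + 1) (fundamentalRep (Fin 3)) (reg.β k))) := by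
  obtain ⟨reg, -, -, -, -, M₀, hM₀, c, -, h⟩ := h Nf hNf
  refine ⟨reg, M₀, hM₀, fun m hm => ?_⟩
  obtain ⟨hE, η, hη, hT⟩ := h m hm
  refine ⟨η, hη, fun f₀ M hM ε hε => ?_⟩
  have hE' : Extinct Nf reg c m := hE
  filter_upwards [eventually_absIndexRatio_le_of_extinct_scheme reg hE' f₀ hε, hT M hM] with k hEk hTk
  exact ⟨hEk, hTk⟩

end AboveLine

end Summit.QuantumFields.QCD.Theorems.WindowExtinction.Negative

end
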